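/-
Origin: expansion seat `prover-pub-hodgecm-mc-binder-2-g11-0`, handover #45 2026-08-20T03:51Z md5 784fa09c9ce1 (122 l.; CERTIFIED rc 0 / 0 warn / 31.6 s; imports #28 `Ins` only; place eigen-equations pass from the GENERATOR to EVERY printed vector (printed local spaces are cyclic: `span{P^k}`, `ℂ·1`, `ℂ·det z`): `linSubst_emb_of_eq_iota` (`linSubst M (rename jI detZ) = c • … ⇒ linSubst M (d.emb vac y) = c • d.emb vac y` for every `y`, `d = iota jI`), `linSubst_emb_of_eq_sigmaPos` / `_sigmaNeg` (fixing every `rename idx (P^k)` ⇒ fixing every printed vector, `Submodule.span_induction`), family form `linSubst_placePoly_of_eq_iota`; consumers: #15/#20 (Σ, K_V-letters) and #16/#36/#44 (ι₁; torus and K_V letters) now apply to GENERAL printed vectors in `omg_ins`/`ins_mem`; NAME LIST `HodgeCM.Model.HypCensus.linSubst_emb_of_eq_iota`, `HodgeCM.Model.HypCensus.linSubst_emb_of_eq_sigmaPos`, `HodgeCM.Model.HypCensus.linSubst_placePoly_of_eq_iota`; axioms: no new) (`HOME/mc/pub-hodgecm-mc-binder-2/g11/pkg/HodgeCM/Model/HypCensus/PlaceEigen.lean`,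 md5 784fa09c9ce1, 124 lines);
landed by the second packager p2 gen 2 (p2-g2) in gate run 40 as `HodgeCM/Model/HypCensus/PlaceEigen.lean` (verbatim).
-/
/-
Origin: speedrun cell pub-hodgecm, MODEL-CONSTRUCTION sub-cell, lineage mc-binder-2 (BINDER-OWNERS rows 18/19: E binders
`hyp12` / `hyp34` of `Model.perL_picardCM_r15A`), seat prover-pub-hodgecm-mc-binder-2-g11-0 (gen 11), 2026-08-20.
Target in PKG: `HodgeCM/Model/HypCensus/PlaceEigen.lean` (NEW additive leaf; imports this lineage's `HypCensus/Ins` (#28, RUN 38)).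
KERNEL ONLY: 0 records, nothing cited as hypothesis, 0 `def … : Prop`; theorems only.
-/
import Summits.HodgeConjecture.HodgeCM.Model.HypCensus.Ins

/-!
# Census kit (rows A12/A34): place eigen-equations pass from the GENERATOR to EVERY printed vector

The printed local spaces are cyclic: `Σ₁₂ ↦ kappaPartM = span{P^k}`, `D₁₂ ↦ kappaPartE = ℂ·1`, `ι₁ ↦ kappaPartI = ℂ·det z`
(`PerL34/ArchBGen`).  Hence a substitution `M` that fixes every `rename idx (P^k)` (resp. scales `rename idx (det z)` by `c`) fixes
(resp. scales by `c`) the embedded image `d.emb vac y` of EVERY printed vector `y` of a place datum `d = sigmaPos … / sigmaNeg … / iota …`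
— the datum-level form in which #15/#20 (Σ, `K_V`-letters), #16/#36/#44 (ι₁, torus and `K_V` letters) feed `omg_ins` / `ins_mem` for
general printed vectors (the delta kind is #43 `linSubst_placePoly_of_delta`, unconditional).

* `linSubst_emb_of_eq_iota`, `linSubst_emb_of_eq_sigmaPos`, `linSubst_emb_of_eq_sigmaNeg` (datum `d` with `d = …` as a hypothesis, so that
  they apply to `datumAt` through `datumAt_of_eq/_of_sigma…`), and the `placePoly` corollaries `linSubst_placePoly_of_eq_iota/…`.

Nothing here is a claim of PerL/QW8.
-/

set_option autoImplicit false

noncomputable section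

open NumberField NumberField.InfinitePlace
open scoped Classical
open MvPolynomial
open Literature.NumberTheory.Automorphic Literature.NumberTheory.Automorphic.UnitaryGroup Literature.NumberTheory.Weil1964
open Literature.RepresentationTheory.KonnoKonno2007 Literature.RepresentationTheory.KonnoKonno2007.RealDualPair
open Literature.NumberTheory.GelbartRogawski1991 Literature.NumberTheory.GelbartRogawski1991.UnitaryDualPair
open Literature.Analysis.SegalBargmann
open HodgeCM.PerL34.Fock HodgeCM.PerL34.Fock.PrintDict

namespace HodgeCM.Model.HypCensus

section Place

variable (L : Type) [Field L] [NumberField L] [IsCMField L]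
variable (dV : Fin 3 → L) (hdV : ∀ i, IsCMField.complexConj L (dV i) = dV i)
variable (dW : Fin 2 → L) (hdW : ∀ i, IsCMField.complexConj L (dW i) = dW i) (ι₁ : L →+* ℂ)
variable (v : {v : InfinitePlace ↥(maximalRealSubfield L) // v.IsReal})

/-- **ι₁ place: an eigen-equation on `rename jI (det z)` holds on every printed vector.** -/
theorem linSubst_emb_of_eq_iota (jI : HodgeCM.PerL34.Fock.PlaneVar → Fin 6) (M : Matrix (Fin 6) (Fin 6) ℂ) (c : ℂ)
    (hc : linSubst M (rename jI HodgeCM.PerL34.Fock.detZ) = c • rename jI HodgeCM.PerL34.Fock.detZ) :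
    ∀ (d : PlaceDatum L dV hdV dW hdW ι₁ v), d = PlaceDatum.iota jI → ∀ (vac : Circle × Circle →* Circle)
      (y : (printLoc d.lam d.lam_ne_zero vac d.kind).M), linSubst M (d.emb vac y) = c • d.emb vac y := by
  rintro d rfl vac y
  change linSubst M (rename jI (kappaPartI.subtype y)) = c • rename jI (kappaPartI.subtype y)
  obtain ⟨a, ha⟩ := Submodule.mem_span_singleton.1 (show ↥kappaPartI from y).2
  rw [Submodule.subtype_apply, ← ha, map_smul, map_smul, hc, smul_comm]

/-- **Σ₁₂ place, `V` read positive: a substitution fixing every `rename idx (P^k)` fixes every printed vector.** -/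
theorem linSubst_emb_of_eq_sigmaPos (eA : Fin 3 ≃ PosIdx (cmXV L dV hdV ι₁ v)) (hQ : IsEmpty (NegIdx (cmXV L dV hdV ι₁ v)))
    (r₀ : PosIdx (cmXW L dV dW hdW ι₁ v)) (s₀ : NegIdx (cmXW L dV dW hdW ι₁ v))
    (hR : Subsingleton (PosIdx (cmXW L dV dW hdW ι₁ v))) (hS : Subsingleton (NegIdx (cmXW L dV dW hdW ι₁ v)))
    (M : Matrix (Fin 6) (Fin 6) ℂ)
    (hP : ∀ k : ℕ, linSubst M (rename (PlaceDatum.sigmaPos eA hQ r₀ s₀ hR hS : PlaceDatum L dV hdV dW hdW ι₁ v).idx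
        (HodgeCM.PerL34.Fock.P ^ k)) = rename (PlaceDatum.sigmaPos eA hQ r₀ s₀ hR hS : PlaceDatum L dV hdV dW hdW ι₁ v).idx
        (HodgeCM.PerL34.Fock.P ^ k)) :
    ∀ (d : PlaceDatum L dV hdV dW hdW ι₁ v), d = PlaceDatum.sigmaPos eA hQ r₀ s₀ hR hS → ∀ (vac : Circle × Circle →* Circle)
      (y : (printLoc d.lam d.lam_ne_zero vac d.kind).M), linSubst M (d.emb vac y) = d.emb vac y := by
  rintro d rfl vac y
  change linSubst M (rename (PlaceDatum.sigmaPos eA hQ r₀ s₀ hR hS : PlaceDatum L dV hdV dW hdW ι₁ v).idx (kappaPartM.subtype y)) =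
    rename (PlaceDatum.sigmaPos eA hQ r₀ s₀ hR hS : PlaceDatum L dV hdV dW hdW ι₁ v).idx (kappaPartM.subtype y)
  have hy := (show ↥kappaPartM from y).2
  rw [Submodule.subtype_apply]
  refine Submodule.span_induction (p := fun f _ => linSubst M (rename _ f) = rename _ f) ?_ ?_ ?_ ?_ hy
  · rintro _ ⟨k, rfl⟩; exact hP k
  · rw [map_zero, map_zero]
  · intro f g _ _ hf hg; rw [map_add, map_add, hf, hg]
  · intro a f _ hf; rw [map_smul, map_smul, hf]

/-- **Σ₁₂ place, `V` read negative**: the same. -/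
theorem linSubst_emb_of_eq_sigmaNeg (eA : Fin 3 ≃ NegIdx (cmXV L dV hdV ι₁ v)) (hP0 : IsEmpty (PosIdx (cmXV L dV hdV ι₁ v)))
    (r₀ : PosIdx (cmXW L dV dW hdW ι₁ v)) (s₀ : NegIdx (cmXW L dV dW hdW ι₁ v))
    (hR : Subsingleton (PosIdx (cmXW L dV dW hdW ι₁ v))) (hS : Subsingleton (NegIdx (cmXW L dV dW hdW ι₁ v)))
    (M : Matrix (Fin 6) (Fin 6) ℂ)
    (hP : ∀ k : ℕ, linSubst M (rename (PlaceDatum.sigmaNeg eA hP0 r₀ s₀ hR hS : PlaceDatum L dV hdV dW hdW ι₁ v).idx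
        (HodgeCM.PerL34.Fock.P ^ k)) = rename (PlaceDatum.sigmaNeg eA hP0 r₀ s₀ hR hS : PlaceDatum L dV hdV dW hdW ι₁ v).idx
        (HodgeCM.PerL34.Fock.P ^ k)) :
    ∀ (d : PlaceDatum L dV hdV dW hdW ι₁ v), d = PlaceDatum.sigmaNeg eA hP0 r₀ s₀ hR hS → ∀ (vac : Circle × Circle →* Circle)
      (y : (printLoc d.lam d.lam_ne_zero vac d.kind).M), linSubst M (d.emb vac y) = d.emb vac y := by
  rintro d rfl vac y
  change linSubst M (rename (PlaceDatum.sigmaNeg eA hP0 r₀ s₀ hR hS : PlaceDatum L dV hdV dW hdW ι₁ v).idx (kappaPartM.subtype y)) =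
    rename (PlaceDatum.sigmaNeg eA hP0 r₀ s₀ hR hS : PlaceDatum L dV hdV dW hdW ι₁ v).idx (kappaPartM.subtype y)
  have hy := (show ↥kappaPartM from y).2
  rw [Submodule.subtype_apply]
  refine Submodule.span_induction (p := fun f _ => linSubst M (rename _ f) = rename _ f) ?_ ?_ ?_ ?_ hy
  · rintro _ ⟨k, rfl⟩; exact hP k
  · rw [map_zero, map_zero]
  · intro f g _ _ hf hg; rw [map_add, map_add, hf, hg]
  · intro a f _ hf; rw [map_smul, map_smul, hf]

end Place

/-! ## §2 On place polynomials of a family -/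

section Family

variable (L : Type) [Field L] [NumberField L] [IsCMField L]
variable (dV : Fin 3 → L) (hdV : ∀ i, IsCMField.complexConj L (dV i) = dV i)
variable (dW : Fin 2 → L) (hdW : ∀ i, IsCMField.complexConj L (dW i) = dW i) (ι₁ : L →+* ℂ)
variable (datum : ∀ b : InfinitePlace L, PlaceDatum L dV hdV dW hdW ι₁ (cmPlacesEquiv L b)) (m₁ m₂ : InfinitePlace L → ℤ)

/-- **at a place whose datum is `iota jI`, an eigen-equation on `rename jI (det z)` holds on every place polynomial.** -/
theorem linSubst_placePoly_of_eq_iota (w : {v : InfinitePlace ↥(maximalRealSubfield L) // v.IsReal})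
    (jI : HodgeCM.PerL34.Fock.PlaneVar → Fin 6) (hι : datum ((cmPlacesEquiv L).symm w) = PlaceDatum.iota jI)
    (M : Matrix (Fin 6) (Fin 6) ℂ) (c : ℂ) (hc : linSubst M (rename jI HodgeCM.PerL34.Fock.detZ) = c • rename jI HodgeCM.PerL34.Fock.detZ)
    (m : ∀ b : InfinitePlace L, ((printPlaces (InfinitePlace L) (kindOf L dV hdV dW hdW ι₁ datum)
      (lamOf L dV hdV dW hdW ι₁ datum) (lamOf_ne_zero L dV hdV dW hdW ι₁ datum)
      (pinnedVacs (kindOf L dV hdV dW hdW ι₁ datum) m₁ m₂)).loc b).M) :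
    linSubst M (placePoly L dV hdV dW hdW ι₁ datum m₁ m₂ m w) = c • placePoly L dV hdV dW hdW ι₁ datum m₁ m₂ m w :=
  linSubst_emb_of_eq_iota L dV hdV dW hdW ι₁ _ jI M c hc (datum ((cmPlacesEquiv L).symm w)) hι
    (pinnedVacs (kindOf L dV hdV dW hdW ι₁ datum) m₁ m₂ ((cmPlacesEquiv L).symm w)) (m ((cmPlacesEquiv L).symm w))

end Family

end HodgeCM.Model.HypCensus

end
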